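import Literature.AnabelianGeometry.AbsoluteAnabelian.AbsTopIII.Thm19KummerContainerLemmas
import HarnessLib

/-!
# [AbsTopIII] Thm. 1.9 (d): the identification `μ_Ẑ(Π_U) := M_Z` is insensitive to base change —
# the change of coefficients along `Π_{Z ×_{k_Z} k′} → Π_Z` is injective on `H¹`

Mochizuki, *Topics in Absolute Anabelian Geometry III*, §1, Theorem 1.9 (b), (d), manuscript pp. 37–38
(lit key `paper:url-5493eb38cbb7`): "`μ_Ẑ(Π_U) := M_Z`" for "`V` rang[ing] over the open subschemes
obtained by removing finite collections of NF-points from `Z ×_{k_Z} k′`, for `k′` a finite extension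
of `k_Z`".

Proof-only companion of abc-iut-w5-d213's `Thm19Steps.lean` (p414129 / p416895, the `H¹`
bookkeeping `cyclotomeModPush` / `cyclotomeModH1Push`) and `Thm19KummerContainer.lean` (p414838,
`IntrinsicKummerModel.pushToZ`), sub-DAG `plan/L4/SUBDAG-AbsTopIII-Thm19.md` row Thm19.d.r8 (cell
abc-iut, claim w5-d099).  For a homomorphism of extensions `f : E → F` ARISING FROM A BASE CHANGE
(`Hom.IsBaseChange`: `Δ_E → Δ_F` bijective) we prove, with no new definition:

* `geomHom_bijective_of_isBaseChange`, `exists_geomHom_inverse` — `f|_Δ : Δ_E ⥲ Δ_F` is an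
  isomorphism of profinite groups (continuous inverse: compact → Hausdorff);
* `exists_geomH2Pull_inverse`, `geomH2Pull_bijective_of_isBaseChange` — `H²(f|_Δ) : H²(Δ_F, Λ) ⥲ H²(Δ_E, Λ)`
  (functoriality of Mathlib's continuous cohomology along the inverse);
* `cyclotomeModPush_bijective_of_isBaseChange` — the change of coefficients `M_E(Λ) ⥲ M_F(Λ)`;
* `cyclotomeModH1Push_injective_of_isBaseChange` — **`H¹(Π_V, M_E(Λ)) → H¹(Π_V, M_F(Λ))` is injective**;
* `IntrinsicKummerModel.pushToZ_injective` — the level-`i` coefficient change of the Kummer container,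
  `H¹(Π_{V_i}, M_{Z ×_{k_Z} k′_i}) → H¹(Π_{V_i}, M_Z)`, is injective (one of the three inputs of the
  injectivity row `Thm19d_inj`).

HONEST FRAMING: homological algebra over Mathlib; nothing here bears on [IUTchIII] Cor. 3.12.
-/

noncomputable section

open CategoryTheory

namespace Literature.AnabelianGeometry.AbsoluteAnabelian.AbsTopIII

universe u

section BaseChange

variable {E' E F : FundamentalExtension.{u}} (Λ : Type u) [AddCommGroup Λ] [TopologicalSpace Λ]
  [IsTopologicalAddGroup Λ]

/-- For a base-change homomorphism, `f|_Δ : Δ_E → Δ_F` is bijective.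
[cite: MochizukiAbsTopIII2015, Thm 1.9 p.38] -/
theorem geomHom_bijective_of_isBaseChange {f : E ⟶ F} (hf : f.IsBaseChange) :
    Function.Bijective (geomHom f) := by
  refine ⟨fun x y hxy => Subtype.ext (hf.bijOn_geom.injOn x.2 y.2 (congrArg Subtype.val hxy)),
    fun y => ?_⟩
  obtain ⟨x, hx, hxy⟩ := hf.bijOn_geom.surjOn y.2
  exact ⟨⟨x, hx⟩, Subtype.ext hxy⟩

/-- For a base-change homomorphism, `f|_Δ` has a CONTINUOUS two-sided inverse `Δ_F → Δ_E` (a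
continuous bijection of profinite groups is a homeomorphism). [cite: MochizukiAbsTopIII2015, Thm 1.9 p.38] -/
theorem exists_geomHom_inverse {f : E ⟶ F} (hf : f.IsBaseChange) :
    ∃ ψ : F.geom →ₜ* E.geom,
      (geomHom f).comp ψ = ContinuousMonoidHom.id F.geom ∧
        ψ.comp (geomHom f) = ContinuousMonoidHom.id E.geom := by
  have hbij := geomHom_bijective_of_isBaseChange hf
  haveI : CompactSpace E.geom := isCompact_iff_compactSpace.mp E.isClosed_geom.isCompact
  let e : E.geom ≃ₜ F.geom :=
    Continuous.homeoOfEquivCompactToT2 (f := Equiv.ofBijective (geomHom f) hbij)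
      (geomHom f).continuous
  have he : ∀ x, e x = geomHom f x := fun _ => rfl
  let m : F.geom ≃* E.geom := (MulEquiv.ofBijective (geomHom f).toMonoidHom hbij).symm
  have hm : ∀ y, m y = e.symm y := fun y => by
    apply hbij.1
    have h1 : geomHom f (m y) = y :=
      (MulEquiv.ofBijective (geomHom f).toMonoidHom hbij).apply_symm_apply y
    have h2 : geomHom f (e.symm y) = y := by rw [← he (e.symm y), e.apply_symm_apply]
    exact h1.trans h2.symm
  let ψ : F.geom →ₜ* E.geom :=
    { toMonoidHom := m.toMonoidHom
      continuous_toFun := by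
        change Continuous fun y => m y
        simp_rw [hm]
        exact e.symm.continuous }
  refine ⟨ψ, ContinuousMonoidHom.ext fun y => ?_, ContinuousMonoidHom.ext fun x => ?_⟩
  · change geomHom f (m y) = y
    rw [hm, ← he, e.apply_symm_apply]
  · change m (geomHom f x) = x
    rw [hm, ← he, e.symm_apply_apply]

/-- `H²(f|_Δ)` is an isomorphism for a base-change homomorphism: it has a two-sided inverse among the
morphisms `H²(Δ_E, Λ) → H²(Δ_F, Λ)` (pull-back along the inverse of `f|_Δ`).
[cite: MochizukiAbsTopIII2015, Thm 1.9 (d) p.37] -/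
theorem exists_geomH2Pull_inverse {f : E ⟶ F} (hf : f.IsBaseChange) :
    ∃ Q : geomH2 E Λ ⟶ geomH2 F Λ, geomH2Pull Λ f ≫ Q = 𝟙 _ ∧ Q ≫ geomH2Pull Λ f = 𝟙 _ := by
  obtain ⟨ψ, h1, h2⟩ := exists_geomHom_inverse hf
  -- the coefficient identity `res ψ (Λ_triv) ⟶ Λ_triv`
  let c : TopRep.res (ψ : F.geom →* E.geom) (geomTrivialRep E Λ) ⟶ geomTrivialRep F Λ :=
    TopRep.ofHom
      { toContinuousLinearMap := ContinuousLinearMap.id ℤ Λ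
        isIntertwining' := fun _ => by
          ext v
          rfl }
  refine ⟨ContinuousCohomology.map ψ c 2, ?_, ?_⟩
  · unfold geomH2Pull
    rw [← ContinuousCohomology.map_comp,
      contCohomologyMap_congr h1 _ (𝟙 (geomTrivialRep F Λ)) rfl 2]
    exact ContinuousCohomology.map_id _ 2
  · unfold geomH2Pull
    rw [← ContinuousCohomology.map_comp,
      contCohomologyMap_congr h2 _ (𝟙 (geomTrivialRep E Λ)) rfl 2]
    exact ContinuousCohomology.map_id _ 2

/-- `H²(f|_Δ) : H²(Δ_F, Λ) → H²(Δ_E, Λ)` is bijective for a base-change homomorphism.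
[cite: MochizukiAbsTopIII2015, Thm 1.9 (d) p.37] -/
theorem geomH2Pull_bijective_of_isBaseChange {f : E ⟶ F} (hf : f.IsBaseChange) :
    Function.Bijective (geomH2Pull Λ f).hom := by
  obtain ⟨Q, hPQ, hQP⟩ := exists_geomH2Pull_inverse Λ hf
  refine ⟨fun x y hxy => ?_, fun y => ⟨Q.hom y, ?_⟩⟩
  · have h := congrArg Q.hom hxy
    have hx : Q.hom ((geomH2Pull Λ f).hom x) = x := by
      change (geomH2Pull Λ f ≫ Q).hom x = x
      rw [hPQ]; rfl
    have hy : Q.hom ((geomH2Pull Λ f).hom y) = y := by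
      change (geomH2Pull Λ f ≫ Q).hom y = y
      rw [hPQ]; rfl
    rwa [hx, hy] at h
  · change (Q ≫ geomH2Pull Λ f).hom y = y
    rw [hQP]; rfl

/-- The change of coefficients `M_E(Λ) → M_F(Λ)`, `m ↦ m ∘ H²(f|_Δ)`, is bijective for a base-change
homomorphism. [cite: MochizukiAbsTopIII2015, Thm 1.9 (d) p.37] -/
theorem cyclotomeModPush_bijective_of_isBaseChange {f : E ⟶ F} (hf : f.IsBaseChange) :
    Function.Bijective (cyclotomeModPush Λ f) := by
  obtain ⟨Q, hPQ, hQP⟩ := exists_geomH2Pull_inverse Λ hf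
  have hPQ' : ∀ ξ, Q.hom ((geomH2Pull Λ f).hom ξ) = ξ := fun ξ => by
    change (geomH2Pull Λ f ≫ Q).hom ξ = ξ
    rw [hPQ]; rfl
  have hQP' : ∀ ξ, (geomH2Pull Λ f).hom (Q.hom ξ) = ξ := fun ξ => by
    change (Q ≫ geomH2Pull Λ f).hom ξ = ξ
    rw [hQP]; rfl
  refine ⟨fun m m' h => ?_, fun n => ?_⟩
  · -- injective: `H²(f|_Δ)` is surjective
    have h' : (cyclotomeModPush Λ f m).toDual = (cyclotomeModPush Λ f m').toDual := by rw [h]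
    rw [cyclotomeModPush_toDual, cyclotomeModPush_toDual] at h'
    change m.toDual = m'.toDual
    refine LinearMap.ext fun ξ => ?_
    have := LinearMap.congr_fun h' (Q.hom ξ)
    rwa [geomCyclotomeDualPush_apply, geomCyclotomeDualPush_apply, hQP'] at this
  · -- surjective: pre-compose with the inverse
    refine ⟨CyclotomeMod.ofDual (n.toDual.comp Q.hom.toLinearMap), ?_⟩
    change CyclotomeMod.toDual _ = n.toDual
    rw [cyclotomeModPush_toDual]
    refine LinearMap.ext fun ξ => ?_
    rw [geomCyclotomeDualPush_apply]
    change n.toDual (Q.hom ((geomH2Pull Λ f).hom ξ)) = n.toDual ξ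
    rw [hPQ']

/-- **The change of coefficients on `H¹` along a base-change homomorphism is injective**:
`H¹(Π_V, M_E(Λ)) → H¹(Π_V, M_F(Λ))` (`cyclotomeModH1Push`, through `r : Π_V → Π_E` and `r ≫ f`) has a
left inverse — Mathlib functoriality of continuous cohomology applied to the inverse coefficient
isomorphism. [cite: MochizukiAbsTopIII2015, Thm 1.9 (d) p.37] -/
theorem cyclotomeModH1Push_injective_of_isBaseChange (r : E' ⟶ E) {f : E ⟶ F} (hf : f.IsBaseChange) :
    Function.Injective (cyclotomeModH1Push Λ r f).hom := by
  classical
  have hbij := cyclotomeModPush_bijective_of_isBaseChange Λ hf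
  obtain ⟨Q, -, hQP⟩ := exists_geomH2Pull_inverse Λ hf
  have hQP' : ∀ ξ, (geomH2Pull Λ f).hom (Q.hom ξ) = ξ := fun ξ => by
    change (Q ≫ geomH2Pull Λ f).hom ξ = ξ
    rw [hQP]; rfl
  -- the inverse of the change of coefficients, as a continuous linear map
  let inv : CyclotomeMod F Λ →L[ℤ] CyclotomeMod E Λ :=
    { toFun := fun n => CyclotomeMod.ofDual (n.toDual.comp Q.hom.toLinearMap)
      map_add' := fun n n' => by
        change CyclotomeMod.ofDual _ = CyclotomeMod.ofDual _
        congr 1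
      map_smul' := fun c n => by
        change CyclotomeMod.ofDual _ = CyclotomeMod.ofDual _
        congr 1
      cont := by
        refine continuous_induced_rng.2 (continuous_pi fun ξ => ?_)
        exact CyclotomeMod.continuous_eval (Q.hom ξ) }
  have hinv : ∀ m, inv (cyclotomeModPush Λ f m) = m := fun m => by
    change CyclotomeMod.ofDual ((cyclotomeModPush Λ f m).toDual.comp Q.hom.toLinearMap) = m
    rw [cyclotomeModPush_toDual]
    change CyclotomeMod.toDual _ = m.toDual
    refine LinearMap.ext fun ξ => ?_
    change geomCyclotomeDualPush Λ f m.toDual (Q.hom ξ) = m.toDual ξ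
    rw [geomCyclotomeDualPush_apply, hQP']
  have hinv' : ∀ n, cyclotomeModPush Λ f (inv n) = n := fun n => by
    obtain ⟨m, rfl⟩ := hbij.2 n
    rw [hinv]
  -- equivariance of the inverse (from that of the forward map)
  have hact : ∀ (g : E'.arith) (n : CyclotomeMod F Λ),
      inv (cyclotomeModRep F Λ ((r ≫ f).arith g) n) = cyclotomeModRep E Λ (r.arith g) (inv n) := by
    intro g n
    apply hbij.1
    rw [hinv', cyclotomeModPush_act, hinv']
    rfl
  let invHom : TopRep.res ((ContinuousMonoidHom.id E'.arith : E'.arith →ₜ* E'.arith) : E'.arith →* E'.arith)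
        (TopRep.res ((r ≫ f).arith : E'.arith →* F.arith) (cyclotomeModTopRep F Λ)) ⟶
      TopRep.res (r.arith : E'.arith →* E.arith) (cyclotomeModTopRep E Λ) :=
    TopRep.ofHom
      { toContinuousLinearMap := inv
        isIntertwining' := fun g => by
          ext n
          exact hact g n }
  -- `push ≫ pull-back-of-inverse = 𝟙`
  have hcomp : cyclotomeModH1Push Λ r f ≫
      ContinuousCohomology.map (ContinuousMonoidHom.id E'.arith) invHom 1 = 𝟙 _ := by
    unfold cyclotomeModH1Push
    rw [← ContinuousCohomology.map_comp]
    have hφ : (ContinuousMonoidHom.id E'.arith).comp (ContinuousMonoidHom.id E'.arith) =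
        ContinuousMonoidHom.id E'.arith := rfl
    have hf' : (TopRep.Hom.hom ((TopRep.resFunctor
          ((ContinuousMonoidHom.id E'.arith : E'.arith →ₜ* E'.arith) : E'.arith →* E'.arith)).map
          (cyclotomePushResHom Λ r f) ≫ invHom)).toContinuousLinearMap =
        (TopRep.Hom.hom (𝟙 (TopRep.res (r.arith : E'.arith →* E.arith)
          (cyclotomeModTopRep E Λ)))).toContinuousLinearMap := by
      ext m
      exact hinv m
    exact (contCohomologyMap_congr hφ _ _ hf' 1).trans (ContinuousCohomology.map_id _ 1)
  -- a morphism with a left inverse is injective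
  set G := ContinuousCohomology.map (ContinuousMonoidHom.id E'.arith) invHom 1
  have hleft : ∀ x, G.hom ((cyclotomeModH1Push Λ r f).hom x) = x := fun x => by
    have h := congrArg (fun φ => TopModuleCat.Hom.hom φ x) hcomp
    simpa only [TopModuleCat.hom_comp, TopModuleCat.hom_id, ContinuousLinearMap.coe_comp,
      Function.comp_apply, ContinuousLinearMap.coe_id', id_eq] using h
  intro x y hxy
  rw [← hleft x, ← hleft y, hxy]

end BaseChange

/-! ### The level coefficient change of the Kummer container is injective -/

namespace IntrinsicKummerModel

variable (M : IntrinsicKummerModel.{u}) {Z : M.Curve} {ι : Type u} [Preorder ι]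
  (S : CurveModel.NFComplementSystem M.toCurveModel Z ι)

/-- **`pushToZ i : H¹(Π_{V_i}, M_{Z ×_{k_Z} k′_i}) → H¹(Π_{V_i}, M_Z)` is injective** (the base-change
leg `Π_{Z ×_{k_Z} k′_i} → Π_Z` of the directed system is a base change, field `isBaseChange`).
[cite: MochizukiAbsTopIII2015, Thm 1.9 (d) p.37] -/
theorem pushToZ_injective (i : ι) : Function.Injective (M.pushToZ S i) := by
  intro x y hxy
  exact cyclotomeModH1Push_injective_of_isBaseChange ZHatCoeff.{u} (M.res (S.isOpen i))
    (S.isBaseChange i) hxy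

end IntrinsicKummerModel

end Literature.AnabelianGeometry.AbsoluteAnabelian.AbsTopIII
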